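import Mathlib
import Literature.NumberTheory.LFunctions.Zhang2022.SkeletonEvalRel
import Literature.NumberTheory.LFunctions.Zhang2022.Section9Statements
import HarnessLib

/-!
# Zhang (2022), typed skeleton — the endgame generic in `𝔠₂` (c-reading of (9.7)) and the relative Lemma 10.2

Topic `Literature/NumberTheory/LFunctions/Zhang2022` (Landau–Siegel audit tree; verdict-neutral).
Y. Zhang, *Discrete mean estimates and the Landau–Siegel zero*, arXiv:2211.02515v1 (2022)
[Zhang2022LandauSiegel] — **an unrefereed manuscript under adjudication** (campaign D-0069). **Every `def`
below is a CLAIM NODE, STATED NOT ASSERTED** (a named hypothesis of the whole-DAG theorem); the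
theorems are kernel-checked bookkeeping between nodes. Two re-typings of record (sz-skel, skeleton owner):

1. **(9.7) in the c-reading** (GAP row G-d17-2, «restate consumer»): substituting `x = P^z` in the §9
   displays gives the prefactor `1/((0.5)(0.498)π)` — the tree's `frakc2c = 6.98709…`, the value that
   reproduces the printed digits of `c₃₄` — and not the printed `1/((0.504)(0.498)π)` (`frakc2 =
   6.99491…`); the derivable §9 chain (sz-d17: `Section9Discharge.eval97c_of_step9u004r`) concludes
   `Section9Statements.Eval97c`. So that the whole-DAG theorem can consume EITHER reading, the §2/§18
   endgame (`SkeletonAssembly.ineq232_of_evals`, `prop26_of_evals`; `SkeletonEvalRel.ineq232_of_evals_rel`,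
   `theorem1_of_evaluations_rel`) is re-proved here GENERIC in the value `k` of `𝔠₂`: nodes
   `Eval97With c′ k` ((9.7) with `𝔠₂ := k`) and `Margin232With k` (`𝔠₁ + k + 2(Re 𝔠₃ + 10⁻⁵) < 0.001`),
   `rfl`-bridges to `Eval97`/`Eval97c`/`Margin232`, the endgame `ineq232_of_evals_with`,
   `prop26_of_evals_with`, `theorem1_of_evaluations_with`, and the kernel refutation
   `not_margin232With_of_le : frakc2c.re ≤ k → ¬ Margin232With k` (from `margin232_total_gt`): the margin
   FAILS for every reading of `𝔠₂` at least as large as the favourable one — in particular for both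
   typed readings (`not_margin232c`, and `not_margin232` again). Proof node `Ded97cRel c′` = (9.1)–(9.7)
   in the c-reading from the relative Lemmas 8.3–8.4.
2. **Lemma 10.2 in RELATIVE form** (sz-d43 01:10Z, same class as G-d55-3 / G-adj1-1 for Lemmas 8.3–8.4):
   the contour-shift proof of (10.8)–(10.10) delivers the error `C𝓛⁻¹⁵·∏_{q∣dr}(1 − q⁻¹)⁻²`, not the
   printed absolute `O(𝓛⁻¹⁵)`. Node `Lemma102Rel c′` = the banked `Lemma102 c′` verbatim except that the
   three bounds of (10.8)–(10.10) carry the factor `(∏_{q∣dr}(1 − q⁻¹)⁻¹)²` ((10.11) as banked); proof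
   nodes `Ded1017RelB c′` / `Ded183Rel c′` = the banked `Ded1017Rel` / `Ded183` with `Lemma102Rel` as the
   Lemma-10.2 input; comparison edges `lemma102Rel_of_lemma102`, `ded1017Rel_of_ded1017RelB`,
   `ded183_of_ded183Rel`.

What is NOT asserted: (9.7) in either reading, Lemma 10.2 in either form, any `Ded…` node, Theorem 1.
Nothing here is a claim about Landau–Siegel zeros.

## References

* Y. Zhang, arXiv:2211.02515v1 (2022), §9 (9.5)–(9.7) p. 52 (tex L2638–L2669), §10 Lemma 10.2
  pp. 20–21 ((10.8)–(10.11)), §11 p. 23, §18 p. 36, §2 p. 6. [cite: Zhang2022LandauSiegel, §9 (9.7)]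
-/

noncomputable section

open Complex Real

namespace Literature.NumberTheory.LFunctions.Zhang2022.Skeleton

/-! ## Nodes -/

section Nodes

variable (c' : ℝ)

/-- **(9.7) with the value of `𝔠₂` as a parameter `k`** (§9 p. 19 / p. 52): "`Ξ₁₂ = 𝔠₂𝔞𝔓 + o(𝔓)`" read
with `𝔠₂ := k`; `k = frakc2.re` is the banked `Eval97` (printed prefactor), `k = frakc2c.re` is
`Section9Statements.Eval97c` (c-reading, G-d17-2) — both by `Iff.rfl` below. CLAIM (family).
[cite: Zhang2022LandauSiegel, §9 (9.7)] -/
def Eval97With (k : ℝ) : Prop :=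
  ∀ ε : ℝ, 0 < ε → ForAllLarge fun D _ χ => AssumptionA D χ →
    |xi12 c' χ - k * frakA χ * frakP D| ≤ ε * frakP D

/-- **The §18 margin with the value of `𝔠₂` as a parameter `k`** (p. 36): "`𝔠₁ + 𝔠₂ + 2Re{𝔠₃} < 0.001`"
with `𝔠₂ := k` (`𝔠₃` = the explicit `frakc3` plus its worst-case rounding term `10⁻⁵`, as in the banked
`Margin232`, which is the case `k = frakc2.re` by `Iff.rfl`). CLAIM (family) — REFUTED below for every
`k ≥ frakc2c.re`. [cite: Zhang2022LandauSiegel, §18 p. 36] -/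
def Margin232With (k : ℝ) : Prop := frakc1.re + k + 2 * (frakc3.re + 1e-5) < 0.001

/-- **(9.1)–(9.7) in the c-reading from the relative Lemmas 8.3–8.4** (the banked `Ded97Rel` with the
conclusion `Section9Statements.Eval97c`). CLAIM (proof node). [cite: Zhang2022LandauSiegel, §9 (9.1)–(9.7)] -/
def Ded97cRel : Prop :=
  Eq91 c' → Prop71 c' → Lemma82 c' → Lemma83Rel c' → Lemma84Rel c' → Section9Statements.Eval97c c'

/-- **Lemma 10.2, RELATIVE form** (§10 pp. 20–21): the four ranges (10.8)–(10.11) for `𝔳₂ⱼ(d,r)` — the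
banked `Lemma102 c′` verbatim except that the bounds of (10.8), (10.9), (10.10) read
`C𝓛⁻¹⁵·(∏_{q∣dr}(1 − q⁻¹)⁻¹)²` ((10.11) unchanged). CLAIM, stated not asserted (sz-d43's derivable form).
[cite: Zhang2022LandauSiegel, §10 Lemma 10.2] -/
def Lemma102Rel : Prop :=
  ∃ C : ℝ, ForAllLarge fun D _ χ => AssumptionA D χ →
    ∀ j ∈ ({1, 2, 3} : Finset ℕ), ∀ d r : ℕ, 1 ≤ d → 1 ≤ r →
      (((d * r : ℕ) : ℝ) ≤ bigP D ^ (0.5 : ℝ) / bigT D →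
        ‖frakv2 c' χ j d r - deriv χ.LFunction 1 * PiW χ d r / 500 *
          (betaJ c' D (j + 1) * betaJ c' D (j + 2)) * Real.log (bigP D)‖ ≤
            C * (ell D ^ 15)⁻¹ * (∏ q ∈ (d * r).primeFactors, (1 - (q : ℝ)⁻¹)⁻¹) ^ 2) ∧
      (bigP D ^ (0.5 : ℝ) < ((d * r : ℕ) : ℝ) → ((d * r : ℕ) : ℝ) ≤ bigP D ^ (0.502 : ℝ) / bigT D →
        ‖frakv2 c' χ j d r - 500 * deriv χ.LFunction 1 * PiW χ d r / Real.log (bigP D) *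
          (-1 + fraky1 c' D j ((d * r : ℕ) : ℝ))‖ ≤
            C * (ell D ^ 15)⁻¹ * (∏ q ∈ (d * r).primeFactors, (1 - (q : ℝ)⁻¹)⁻¹) ^ 2) ∧
      (bigP D ^ (0.502 : ℝ) < ((d * r : ℕ) : ℝ) →
        ((d * r : ℕ) : ℝ) ≤ bigP D ^ (0.504 : ℝ) / bigT D →
        ‖frakv2 c' χ j d r - 500 * deriv χ.LFunction 1 * PiW χ d r / Real.log (bigP D) *
          (1 + fraky2 c' D j ((d * r : ℕ) : ℝ))‖ ≤
            C * (ell D ^ 15)⁻¹ * (∏ q ∈ (d * r).primeFactors, (1 - (q : ℝ)⁻¹)⁻¹) ^ 2) ∧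
      ((bigP D ^ (0.5 : ℝ) / bigT D < ((d * r : ℕ) : ℝ) ∧ ((d * r : ℕ) : ℝ) ≤ bigP D ^ (0.5 : ℝ)) ∨
          (bigP D ^ (0.502 : ℝ) / bigT D < ((d * r : ℕ) : ℝ) ∧
            ((d * r : ℕ) : ℝ) ≤ bigP D ^ (0.502 : ℝ)) ∨
          (bigP D ^ (0.504 : ℝ) / bigT D < ((d * r : ℕ) : ℝ) ∧
            ((d * r : ℕ) : ℝ) < bigP D ^ (0.504 : ℝ)) →
        ‖frakv2 c' χ j d r‖ ≤ C * (ell D ^ 7)⁻¹)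

/-- **(10.12)–(10.17) from the relative Lemmas 8.3, 8.4 AND 10.2** (the banked `Ded1017Rel` with
`Lemma102Rel` as its Lemma-10.2 input). CLAIM (proof node). [cite: Zhang2022LandauSiegel, §10 (10.12)–(10.17)] -/
def Ded1017RelB : Prop :=
  Eq101 c' → Prop71 c' → Lemma82 c' → Lemma83Rel c' → Lemma84Rel c' → Lemma101 c' →
    Lemma102Rel c' → Eval1017 c'

/-- **§18 pp. 36–37, the bound for (18.3), from Lemma 10.1 and the relative Lemma 10.2** (the banked
`Ded183` with `Lemma102Rel` as its Lemma-10.2 input). CLAIM (proof node).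
[cite: Zhang2022LandauSiegel, §18 pp. 36–37] -/
def Ded183Rel : Prop := Eq183 c' → Prop71 c' → Lemma101 c' → Lemma102Rel c' → Bound183 c'

end Nodes

/-! ## Bridges and comparison edges -/

section Edges

variable {c' : ℝ}

/-- `Eval97With c′ 𝔠₂` IS the banked (9.7). [cite: Zhang2022LandauSiegel, §9 (9.7)] -/
theorem eval97With_frakc2_iff : Eval97With c' frakc2.re ↔ Eval97 c' := Iff.rfl

/-- `Eval97With c′ 𝔠₂ᶜ` IS the c-reading `Section9Statements.Eval97c`. [cite: Zhang2022LandauSiegel, §9 (9.7)] -/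
theorem eval97With_frakc2c_iff : Eval97With c' frakc2c.re ↔ Section9Statements.Eval97c c' := Iff.rfl

/-- `Margin232With 𝔠₂` IS the banked `Margin232`. [cite: Zhang2022LandauSiegel, §18 p. 36] -/
theorem margin232With_frakc2_iff : Margin232With frakc2.re ↔ Margin232 := Iff.rfl

/-- **The margin fails for every reading of `𝔠₂` at least the favourable one** (`k ≥ frakc2c.re =
6.98709…`): by the tree's certificates `𝔠₁ + 𝔠₂ᶜ + 2(Re 𝔠₃ − 10⁻⁵) > 0.05` (`margin232_total_gt`).
[cite: Zhang2022LandauSiegel, §18 p. 36] -/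
theorem not_margin232With_of_le {k : ℝ} (hk : frakc2c.re ≤ k) : ¬ Margin232With k := by
  rw [Margin232With]
  have h := margin232_total_gt
  intro hm
  linarith

/-- The c-reading of the margin fails. [cite: Zhang2022LandauSiegel, §18 p. 36] -/
theorem not_margin232c : ¬ Margin232With frakc2c.re := not_margin232With_of_le le_rfl

/-- The printed reading fails (again; `frakc2c.re ≤ frakc2.re` from the certificates).
[cite: Zhang2022LandauSiegel, §18 p. 36] -/
theorem not_margin232With_frakc2 : ¬ Margin232With frakc2.re :=
  fun h => not_margin232 (margin232With_frakc2_iff.mp h)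

/-- The printed (absolute) Lemma 10.2 implies the relative form (`∏_{q∣dr}(1 − q⁻¹)⁻² ≥ 1`).
[cite: Zhang2022LandauSiegel, §10 Lemma 10.2] -/
theorem lemma102Rel_of_lemma102 (h : Lemma102 c') : Lemma102Rel c' := by
  obtain ⟨C, hC⟩ := h
  refine ⟨|C|, hC.mono fun D _ χ _ _ hS hA j hj d r hd hr => ?_⟩
  obtain ⟨h1, h2, h3, h4⟩ := hS hA j hj d r hd hr
  have hprod : 1 ≤ ∏ q ∈ (d * r).primeFactors, (1 - (q : ℝ)⁻¹)⁻¹ := by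
    refine le_of_eq_of_le (Finset.prod_const_one (s := (d * r).primeFactors)).symm
      (Finset.prod_le_prod (fun _ _ => zero_le_one) fun q hq => ?_)
    have hq2 : (2 : ℝ) ≤ q := by exact_mod_cast (Nat.prime_of_mem_primeFactors hq).two_le
    have h1 : 0 < 1 - (q : ℝ)⁻¹ := by
      have : (q : ℝ)⁻¹ ≤ 1 / 2 := by rw [inv_eq_one_div]; gcongr
      linarith
    have h2 : 1 - (q : ℝ)⁻¹ ≤ 1 := by
      have : 0 ≤ (q : ℝ)⁻¹ := by positivity
      linarith
    exact (one_le_inv₀ h1).mpr h2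
  have hℓ0 : 0 ≤ ell D := by rw [ell]; exact Real.log_natCast_nonneg D
  have hℓ : 0 ≤ (ell D ^ 15)⁻¹ := by positivity
  have lift : C * (ell D ^ 15)⁻¹ ≤
      |C| * (ell D ^ 15)⁻¹ * (∏ q ∈ (d * r).primeFactors, (1 - (q : ℝ)⁻¹)⁻¹) ^ 2 := by
    calc C * (ell D ^ 15)⁻¹ ≤ |C| * (ell D ^ 15)⁻¹ := by gcongr; exact le_abs_self _
      _ = |C| * (ell D ^ 15)⁻¹ * 1 ^ 2 := by ring
      _ ≤ |C| * (ell D ^ 15)⁻¹ * (∏ q ∈ (d * r).primeFactors, (1 - (q : ℝ)⁻¹)⁻¹) ^ 2 := by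
          gcongr
  have lift7 : C * (ell D ^ 7)⁻¹ ≤ |C| * (ell D ^ 7)⁻¹ := by
    have h7 : 0 ≤ (ell D ^ 7)⁻¹ := by positivity
    exact mul_le_mul_of_nonneg_right (le_abs_self _) h7
  exact ⟨fun ha => (h1 ha).trans lift, fun ha hb => (h2 ha hb).trans lift,
    fun ha hb => (h3 ha hb).trans lift, fun hw => (h4 hw).trans lift7⟩

/-- `Ded1017RelB` (Lemma 10.2 relative among the inputs) implies the banked `Ded1017Rel`.
[cite: Zhang2022LandauSiegel, §10 (10.17)] -/
theorem ded1017Rel_of_ded1017RelB (h : Ded1017RelB c') : Ded1017Rel c' :=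
  fun h101 h71 h82 h83 h84 hL1 hL2 => h h101 h71 h82 h83 h84 hL1 (lemma102Rel_of_lemma102 hL2)

/-- `Ded183Rel` implies the banked `Ded183`. [cite: Zhang2022LandauSiegel, §18 pp. 36–37] -/
theorem ded183_of_ded183Rel (h : Ded183Rel c') : Ded183 c' :=
  fun h183 h71 hL1 hL2 => h h183 h71 hL1 (lemma102Rel_of_lemma102 hL2)

/-- The banked `Ded97Rel` gives `Eval97With c′ 𝔠₂`; `Ded97cRel` gives `Eval97With c′ 𝔠₂ᶜ` (plumbing for
the generic endgame). [cite: Zhang2022LandauSiegel, §9 (9.7)] -/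
theorem eval97With_of_ded97cRel (h : Ded97cRel c') (h91 : Eq91 c') (h71 : Prop71 c') (h82 : Lemma82 c')
    (h83 : Lemma83Rel c') (h84 : Lemma84Rel c') : Eval97With c' frakc2c.re :=
  eval97With_frakc2c_iff.mpr (h h91 h71 h82 h83 h84)

end Edges

/-! ## The endgame generic in `𝔠₂` -/

section Endgame

variable {c' : ℝ} {k : ℝ}

/-- **§18 p. 36 with relative errors and `𝔠₂ := k`: "(8.23), (9.7) and (18.1) yield (2.32)"** — the
proof of `SkeletonEvalRel.ineq232_of_evals_rel` verbatim with `frakc2.re` replaced by `k` (the `o((𝔞+1)𝔓)`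
error is absorbed through `𝔞 ≥ a₀`: `ε = m·a₀/(8 + 4a₀)`, `m = 0.001 − (𝔠₁ + k + 2(Re 𝔠₃ + 10⁻⁵))`).
[cite: Zhang2022LandauSiegel, §18 p. 36] -/
theorem ineq232_of_evals_with (h22 : Prop22i) (h23 : Lemma23 c') (hprim : PsiChiPrimitive)
    (h823 : Eval823 c') (h97 : Eval97With c' k) (h181 : Eval181Rel c') (hm : Margin232With k)
    (ha : FrakALowerBound) : Ineq232 c' := by
  obtain ⟨a₀, ha₀, ha⟩ := ha
  obtain ⟨D₁, hP⟩ := frakP_eventually_pos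
  rw [Margin232With] at hm
  set m : ℝ := 0.001 - (frakc1.re + k + 2 * (frakc3.re + 1e-5)) with hm_def
  have hm0 : 0 < m := by rw [hm_def]; linarith
  set ε : ℝ := m * a₀ / (8 + 4 * a₀) with hε
  have hε0 : 0 < ε := by positivity
  have hεid : ε * (8 + 4 * a₀) = m * a₀ := by rw [hε]; field_simp
  obtain ⟨D₀, h⟩ := ((((h22.and h23).and (h823 ε hε0)).and (h97 ε hε0)).and (h181 ε hε0)).and ha
  refine ⟨max (max D₀ D₁) 3, fun D _ χ hD hq hp hA => ?_⟩
  have hD3 : 3 ≤ D := le_trans (le_max_right _ _) hD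
  have hD₀ : D₀ ≤ D := le_trans (le_trans (le_max_left _ _) (le_max_left _ _)) hD
  have hD₁ : D₁ ≤ D := le_trans (le_trans (le_max_right _ _) (le_max_left _ _)) hD
  obtain ⟨⟨⟨⟨⟨h22', h23'⟩, h823'⟩, h97'⟩, h181'⟩, ha'⟩ := h D χ hD₀ hq hp
  have hPpos : 0 < frakP D := hP D hD₁
  have haa : a₀ ≤ frakA χ := ha' hA
  have e1 := abs_le.mp (h823' hA)
  have e2 := abs_le.mp (h97' hA)
  have e3 : |(xi13 c' χ).re - frakc3.re * frakA χ * frakP D| ≤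
      1e-5 * frakA χ * frakP D + ε * (frakA χ + 1) * frakP D := by
    have h3 := h181' hA
    have : (xi13 c' χ - frakc3 * frakA χ * frakP D).re =
        (xi13 c' χ).re - frakc3.re * frakA χ * frakP D := by
      simp [Complex.sub_re, Complex.mul_re]
    rw [← this]
    exact le_trans (Complex.abs_re_le_norm _) h3
  have e3' := abs_le.mp e3
  rw [xi1_eq_of χ hD3 h23' h22' (fun x => hprim D χ x hD3 hp)]
  have hA0 : 0 < frakA χ := lt_of_lt_of_le ha₀ haa
  have h4 : ε * (4 + 2 * frakA χ) * frakP D < m * frakA χ * frakP D := by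
    have hlt : ε * (4 + 2 * frakA χ) < m * frakA χ := by
      have h8 : (0 : ℝ) < 8 + 4 * a₀ := by positivity
      have key : ε * (4 + 2 * frakA χ) * (8 + 4 * a₀) < m * frakA χ * (8 + 4 * a₀) := by
        calc ε * (4 + 2 * frakA χ) * (8 + 4 * a₀) = m * a₀ * (4 + 2 * frakA χ) := by
              rw [mul_assoc, mul_comm (4 + 2 * frakA χ), ← mul_assoc, hεid]
          _ = m * (4 * a₀ + 2 * a₀ * frakA χ) := by ring
          _ < m * (8 * frakA χ + 4 * a₀ * frakA χ) := by
              refine mul_lt_mul_of_pos_left ?_ hm0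
              nlinarith
          _ = m * frakA χ * (8 + 4 * a₀) := by ring
      exact lt_of_mul_lt_mul_right key h8.le
    exact mul_lt_mul_of_pos_right hlt hPpos
  nlinarith [e1.2, e2.2, e3'.2]

/-- **§11 p. 23 with `𝔠₂ := k`: "By the result of Section 9, `Ξ₁₂ ≪ 𝔞𝔓`. Hence, by Cauchy's
inequality, the proof of Proposition 2.6 is reduced to showing (11.1)"** — the proof of
`SkeletonAssembly.prop26_of_evals` verbatim with `frakc2.re` replaced by `k` (`Ξ₁₂ ≤ (|k| + 1)𝔞𝔓`).
[cite: Zhang2022LandauSiegel, §11 p. 23] -/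
theorem prop26_of_evals_with (h22 : Prop22i) (h23 : Lemma23 c') (hprim : PsiChiPrimitive)
    (h111 : Eval111 c') (h97 : Eval97With c' k) (ha : FrakALowerBound) : Prop26 c' := by
  intro ε hε
  obtain ⟨a₀, ha₀, ha⟩ := ha
  obtain ⟨D₁, hP⟩ := frakP_eventually_pos
  set K : ℝ := |k| + 1 with hK
  have hK0 : 0 < K := by positivity
  set ε₁ : ℝ := ε ^ 2 / K with hε₁
  have hε₁0 : 0 < ε₁ := by positivity
  obtain ⟨D₀, h⟩ := ((((h22.and h23).and (h111 ε₁ hε₁0)).and (h97 a₀ ha₀)).and ha)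
  refine ⟨max (max D₀ D₁) 3, fun D _ χ hD hq hp hA => ?_⟩
  have hD3 : 3 ≤ D := le_trans (le_max_right _ _) hD
  have hD₀ : D₀ ≤ D := le_trans (le_trans (le_max_left _ _) (le_max_left _ _)) hD
  have hD₁ : D₁ ≤ D := le_trans (le_trans (le_max_right _ _) (le_max_left _ _)) hD
  obtain ⟨⟨⟨⟨h22', h23'⟩, h111'⟩, h97'⟩, ha'⟩ := h D χ hD₀ hq hp
  obtain ⟨hc, hω, -⟩ := pointwise_inputs c' χ hD3 h23' h22' (fun x => hprim D χ x hD3 hp)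
  have hPpos : 0 < frakP D := hP D hD₁
  have haa : a₀ ≤ frakA χ := ha' hA
  have hA0 : 0 < frakA χ := lt_of_lt_of_le ha₀ haa
  set X : ℝ := frakA χ * frakP D with hX
  have hX0 : 0 < X := mul_pos hA0 hPpos
  have hsq : xi3sq c' χ ≤ ε₁ * X := by rw [hX, ← mul_assoc]; exact h111' hA
  have h12 : xi12 c' χ ≤ K * X := by
    have e2 := (abs_le.mp (h97' hA)).2
    have : a₀ * frakP D ≤ X := by rw [hX]; exact mul_le_mul_of_nonneg_right haa hPpos.le
    have : k * frakA χ * frakP D ≤ |k| * X := by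
      rw [hX, ← mul_assoc]; exact mul_le_mul_of_nonneg_right
        (mul_le_mul_of_nonneg_right (le_abs_self _) hA0.le) hPpos.le
    nlinarith
  have hw : ∀ i ∈ idx χ, 0 ≤ (cstar c' D i.1 i.2).re * (omegaW D i.2).re :=
    fun i hi => mul_nonneg (hc i hi).2 (hω i hi).1.le
  have hcs := xiStar3_sq_le χ hw
  have h3nonneg : 0 ≤ xiStar3 c' χ := by
    rw [xiStar3]
    exact Finset.sum_nonneg fun i hi =>
      mul_nonneg (mul_nonneg (hc i hi).2 (by positivity)) (hω i hi).1.le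
  have h12nonneg : 0 ≤ xi12 c' χ := by
    rw [xi12]
    exact Finset.sum_nonneg fun i hi =>
      mul_nonneg (mul_nonneg (hc i hi).2 (by positivity)) (hω i hi).1.le
  have hprod : xi3sq c' χ * xi12 c' χ ≤ (ε₁ * X) * (K * X) :=
    mul_le_mul hsq h12 h12nonneg (by positivity)
  have hεX : (ε₁ * X) * (K * X) = (ε * X) ^ 2 := by
    rw [hε₁]; field_simp
  have hsq2 : xiStar3 c' χ ^ 2 ≤ (ε * X) ^ 2 := le_trans hcs (hεX ▸ hprod)
  have hfin : xiStar3 c' χ ≤ ε * X :=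
    (pow_le_pow_iff_left₀ h3nonneg (by positivity) two_ne_zero).mp hsq2
  simpa [hX, mul_assoc] using hfin

/-- **Theorem 1 from the evaluations, (9.7) and the margin read with `𝔠₂ := k`** (the endgame of
`SkeletonEvalRel.theorem1_of_evaluations_rel` re-run with `ineq232_of_evals_with` / `prop26_of_evals_with`);
`k = frakc2.re` is the banked endgame, `k = frakc2c.re` the c-reading — the margin hypothesis is refuted
in both (`not_margin232With_of_le`). [cite: Zhang2022LandauSiegel, §2 p. 6, §18] -/
theorem theorem1_of_evaluations_with (h22 : Prop22i) (h23 : Lemma23 c')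
    (h1017 : Eval1017 c') (h823 : Eval823 c') (h97 : Eval97With c' k) (h181 : Eval181Rel c')
    (hm : Margin232With k) (h183 : Bound183 c') (h111 : Eval111 c') : Theorem1 :=
  have ha : FrakALowerBound := frakALowerBound_holds
  have hprim : PsiChiPrimitive := psiChiPrimitive_holds
  theorem1_of_props h22 h23 (prop24_of_eval h1017 Prop24Main_holds ha)
    (prop25_of_ineqs h22 h23 hprim (ineq232_of_evals_with h22 h23 hprim h823 h97 h181 hm ha)
      (ineq233_of_bound h183 ha))
    (prop26_of_evals_with h22 h23 hprim h111 h97 ha)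

end Endgame

end Literature.NumberTheory.LFunctions.Zhang2022.Skeleton
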